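import Literature.NumberTheory.EllipticCurves.OrdinaryNewformDatumExistsProofs
import Literature.NumberTheory.EllipticCurves.NewformGaloisRepDetProofs
import Literature.NumberTheory.EllipticCurves.NewformGaloisRepRibetThm23Proofs
import Mathlib.Topology.Algebra.Module.FiniteDimension
import HarnessLib

/-!
# An ordinary newform datum is ATTACHED: its base change to `K = ℚ_p(ι K_g)` (and to `ℚ̄_p`) is a Galois representation of the
# `Γ₁(M)`-lift of `g`, absolutely irreducible (proofs only)

Topic `NumberTheory/EllipticCurves` (namespace `Literature.NumberTheory.EllipticCurves.GreenbergSelmer`). THEOREMS ONLY (no definition,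
no named fact; D-0026). For `Δ : OrdinaryNewformDatum g p ι` (`g ∈ S_k(Γ₀(M))` a newform, `ι : K_g → ℚ̄_p`): the field `charpoly` of
the datum says that `Δ.ρ` is unramified at `ℓ ∤ Mp` with Frobenius characteristic polynomial `X² − ι(a_ℓ)X + ℓ^{k−1}`; this IS
`IsGaloisRepOfNewform1 g₁ j {q ∣ Mp}` for the `Γ₁(M)`-lift `g₁` of `g` (same `q`-expansion, trivial nebentypus:
`coe_liftToGamma1_holds`, `nebentypus_liftToGamma1_holds`, `map_heckePolynomial_of_nebentypus_eq_one`) and the coefficient map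
`j = ι|_{K₁}`, `K₁ = ℚ(a_n, ε) ≤ K_g` (`coeffCharField_liftToGamma1_le`), after base change to `K = ℚ_p(ι K_g)` or to `ℚ̄_p`
(`FramedGaloisRep.hasFrobCharpolyAt_baseChange`). With Ribet's Thm. (2.3) (PROVED in the tree, `Ribet1977.thm23_isIrreducible_holds`)
the base change to `K` is absolutely irreducible (`Ribet1977.isAbsolutelyIrreducible_of_thm23`; `K/ℚ_p` finite carries the module
topology), so the base change to `ℚ̄_p` is irreducible — the two hypotheses under which the named fact
`Hida2000_thm326_ordinary_unitRoot` (Wiles 1988 Thm 2.2) applies to `Δ.ρ`.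

* `OrdinaryNewformDatum.liftCoeffHom` is NOT defined (no definitions): the coefficient map is written `ι.comp (inclusion _)` in place.
* `OrdinaryNewformDatum.isGaloisRepOfNewform1_baseChange_padicCoeffField` — attached over `K`;
* `OrdinaryNewformDatum.isGaloisRepOfNewform1_baseChange_padicAlgCl` — attached over `ℚ̄_p`;
* `isModuleTopology_padicCoeffField` — `K = ℚ_p(ι K_g)`, finite over `ℚ_p`, carries the module topology;
* `OrdinaryNewformDatum.isAbsolutelyIrreducible_baseChange_padicCoeffField`, `OrdinaryNewformDatum.isIrreducible_baseChange_padicAlgCl`.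

Use: cell `bsd-stepL`, crux 25505, stub (FIX), memo `LOCALDEFECT-25505-imc-p1-g23.md` §1ter rows (a)–(b).

References: [DeligneSerre1974] §6; [Ribet1977] Thm. (2.3); [DiamondShurman2005] §4.3, Def. 9.6.4; [Hida2000] Thm. 3.26.
-/

noncomputable section

open scoped MatrixGroups Matrix ModularForm NumberField
open NumberField IsDedekindDomain Field CongruenceSubgroup UpperHalfPlane Rat.HeightOneSpectrum Polynomial
open Literature.NumberTheory.GaloisRepresentations
open Literature.NumberTheory.EllipticCurves.ModularForms

namespace Literature.NumberTheory.EllipticCurves.GreenbergSelmer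

variable {M : ℕ} [NeZero M] {k : ℤ} {g : CuspForm (Gamma0 M) k} {p : ℕ} [Fact p.Prime]
  {ι : coeffField g →+* PadicAlgCl p}

omit [NeZero M] in
/-- `𝒪 → K` (the subring inclusion) is continuous (`𝒪 = {|x| ≤ 1} ⊆ K = ℚ_p(ι K_g)`). [cite: EmertonPollackWeston2006, §3.1 (p. 17, "𝒪 the ring of integers of K")] -/
theorem continuous_padicCoeffIntegers_subtype : Continuous (padicCoeffIntegers ι).subtype :=
  continuous_subtype_val

omit [NeZero M] in
/-- `𝒪 → ℚ̄_p` is continuous (`𝒪 ⊆ K ⊆ ℚ̄_p`). [cite: EmertonPollackWeston2006, §3.1 (p. 17)] -/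
theorem continuous_toPadicAlgCl : Continuous (padicCoeffIntegers.toPadicAlgCl ι) :=
  continuous_subtype_val.comp continuous_subtype_val

/-- A newform is non-zero. [cite: DiamondShurman2005, Def. 5.8.1] -/
theorem isNewform0_ne_zero (hg : IsNewform0 g) : g ≠ 0 := by
  intro h0
  have h1 : IsNormalized g := hg.2.2
  rw [IsNormalized, h0] at h1
  simp [UpperHalfPlane.qExpansion_zero] at h1

/-- The coefficient map `j = ι|_{K₁} : K₁ = ℚ(a_n(g₁), ε) → ℚ̄_p` of the `Γ₁(M)`-lift `g₁` sends `a_n(g₁)` to `ι(a_n(g))`.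
[cite: DiamondShurman2005, §4.3 (S_k(Γ₀(N)) = S_k(N, 𝟙))] -/
theorem liftCoeff_apply_cuspCoeff (hg : IsNewform0 g) (n : ℕ) :
    (ι.comp (IntermediateField.inclusion (coeffCharField_liftToGamma1_le (isNewform0_ne_zero hg))).toRingHom)
        ⟨(qExpansion 1 ⇑(liftToGamma1 M k g)).coeff n, cuspCoeff_mem_coeffCharField (liftToGamma1 M k g) n⟩ =
      ι ⟨(qExpansion 1 ⇑g).coeff n, coeff_mem_coeffField g n⟩ := by
  have hcoe : (⇑(liftToGamma1 M k g) : ℍ → ℂ) = ⇑g := coe_liftToGamma1_holds M k g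
  have hval : (((IntermediateField.inclusion (coeffCharField_liftToGamma1_le (isNewform0_ne_zero hg)))
      ⟨(qExpansion 1 ⇑(liftToGamma1 M k g)).coeff n,
        cuspCoeff_mem_coeffCharField (liftToGamma1 M k g) n⟩ : coeffField g) : ℂ) =
      (qExpansion 1 ⇑g).coeff n := by
    rw [IntermediateField.coe_inclusion]
    change (qExpansion 1 ⇑(liftToGamma1 M k g)).coeff n = (qExpansion 1 ⇑g).coeff n
    rw [hcoe]
  exact congrArg ι (Subtype.ext hval)

/-- **The datum is attached (over any coefficient change `f : 𝒪 → B`)**: `Δ.ρ ⊗_f B` is a Galois representation of the `Γ₁(M)`-lift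
`g₁` away from `M p` through any `jB : K₁ → B` with `jB(a_n(g₁)) = f-image of ι(a_n(g))` — precisely: through `jB` such that
`C (jB a_ℓ(g₁)) = C (f aℓ')` where `Δ.charpoly` provides `P` with `P.map (𝒪 → ℚ̄_p) = X² − ι(a_ℓ)X + ℓ^{k−1}`. Stated for the
two changes used below. First over `ℚ̄_p`. [cite: DeligneSerre1974, §6 (Thm. 6.1)] [cite: DiamondShurman2005, Def. 9.6.4 and §4.3] -/
theorem OrdinaryNewformDatum.isGaloisRepOfNewform1_baseChange_padicAlgCl (Δ : OrdinaryNewformDatum g p ι)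
    (hg : IsNewform0 g) (hk : 1 ≤ k) :
    IsGaloisRepOfNewform1 (liftToGamma1 M k g)
      (ι.comp (IntermediateField.inclusion (coeffCharField_liftToGamma1_le (isNewform0_ne_zero hg))).toRingHom)
      {q | q ∣ M * p} (FramedRep.baseChange (padicCoeffIntegers.toPadicAlgCl ι) continuous_toPadicAlgCl Δ.ρ) := by
  have hp : p.Prime := Fact.out
  have hε : nebentypus (liftToGamma1 M k g) = 1 := nebentypus_liftToGamma1_holds M k (isNewform0_ne_zero hg)
  intro v hv
  have hvM : ¬ ((primesEquiv v : Nat.Primes) : ℕ) ∣ M := fun h ↦ hv (h.mul_right p)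
  have hvp : ((primesEquiv v : Nat.Primes) : ℕ) ≠ p := fun h ↦ hv (by rw [h]; exact Dvd.intro_left M rfl)
  obtain ⟨hur, P, hP, hchar⟩ := Δ.charpoly v hvM hvp
  refine ⟨fun 𝔓 h𝔓 σ hσ ↦ ?_, ?_⟩
  · rw [FramedRep.baseChange_apply, hur 𝔓 h𝔓 σ hσ, map_one]
  · have hcop : ((primesEquiv v : Nat.Primes) : ℕ).Coprime M :=
      (Nat.Prime.coprime_iff_not_dvd (primesEquiv v).2).mpr hvM
    rw [map_heckePolynomial_of_nebentypus_eq_one hε hk hcop, liftCoeff_apply_cuspCoeff hg, ← hP]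
    exact FramedGaloisRep.hasFrobCharpolyAt_baseChange _ _ hchar

omit [NeZero M] in
/-- **`K = ℚ_p(ι K_g)` carries the `ℚ_p`-module topology** (finite-dimensional subspace of the normed space `ℚ̄_p` over the complete
field `ℚ_p`: all linear isomorphisms with `ℚ_pᵈ` are homeomorphisms — equivalence of norms). [cite: NeukirchANT1999, Ch. II Prop. (4.9)] -/
theorem isModuleTopology_padicCoeffField [FiniteDimensional ℚ_[p] (padicCoeffField ι)] :
    IsModuleTopology ℚ_[p] (padicCoeffField ι) :=
  IsModuleTopology.iso (ContinuousLinearEquiv.ofFinrankEq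
    (E := Fin (Module.finrank ℚ_[p] (padicCoeffField ι)) → ℚ_[p]) (F := padicCoeffField ι) (by simp))

omit [NeZero M] in
/-- The base change to `ℚ̄_p` is the base change to `K` followed by `K ⊆ ℚ̄_p` (`ρ_f ⊗ K ⊗ ℚ̄_p`). [cite: EmertonPollackWeston2006, §3.1 (p. 17)] -/
theorem OrdinaryNewformDatum.baseChange_padicAlgCl_eq (Δ : OrdinaryNewformDatum g p ι) :
    FramedRep.baseChange (padicCoeffIntegers.toPadicAlgCl ι) continuous_toPadicAlgCl Δ.ρ =
      FramedRep.baseChange (algebraMap (padicCoeffField ι) (PadicAlgCl p)) continuous_subtype_val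
        (FramedRep.baseChange (padicCoeffIntegers ι).subtype continuous_padicCoeffIntegers_subtype Δ.ρ) := by
  refine ContinuousMonoidHom.ext fun σ ↦ Units.ext ?_
  rw [FramedRep.baseChange_apply, FramedRep.baseChange_apply, FramedRep.baseChange_apply]
  rfl

/-- **The datum is attached over `K = ℚ_p(ι K_g)`**: `Δ.ρ ⊗ K` is a Galois representation of `g₁` away from `M p` through
`jK : K₁ → K`, `jK = ι|_{K₁}` co-restricted to `K`. [cite: DeligneSerre1974, §6 (Thm. 6.1)] [cite: DiamondShurman2005, Def. 9.6.4 and §4.3] -/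
theorem OrdinaryNewformDatum.isGaloisRepOfNewform1_baseChange_padicCoeffField (Δ : OrdinaryNewformDatum g p ι)
    (hg : IsNewform0 g) (hk : 1 ≤ k) :
    IsGaloisRepOfNewform1 (liftToGamma1 M k g)
      ((ι.comp (IntermediateField.inclusion (coeffCharField_liftToGamma1_le (isNewform0_ne_zero hg))).toRingHom).codRestrict
        (padicCoeffField ι).toSubalgebra.toSubring.toSubsemiring fun _ ↦ map_mem_padicCoeffField ι _)
      {q | q ∣ M * p} (FramedRep.baseChange (padicCoeffIntegers ι).subtype continuous_padicCoeffIntegers_subtype Δ.ρ) := by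
  have hp : p.Prime := Fact.out
  have hε : nebentypus (liftToGamma1 M k g) = 1 := nebentypus_liftToGamma1_holds M k (isNewform0_ne_zero hg)
  have hinj : Function.Injective (algebraMap (padicCoeffField ι) (PadicAlgCl p)) := Subtype.val_injective
  intro v hv
  have hvM : ¬ ((primesEquiv v : Nat.Primes) : ℕ) ∣ M := fun h ↦ hv (h.mul_right p)
  have hvp : ((primesEquiv v : Nat.Primes) : ℕ) ≠ p := fun h ↦ hv (by rw [h]; exact Dvd.intro_left M rfl)
  obtain ⟨hur, P, hP, hchar⟩ := Δ.charpoly v hvM hvp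
  refine ⟨fun 𝔓 h𝔓 σ hσ ↦ ?_, ?_⟩
  · rw [FramedRep.baseChange_apply, hur 𝔓 h𝔓 σ hσ, map_one]
  · have hcop : ((primesEquiv v : Nat.Primes) : ℕ).Coprime M :=
      (Nat.Prime.coprime_iff_not_dvd (primesEquiv v).2).mpr hvM
    -- compare after the injective `K → ℚ̄_p`
    rw [← FramedGaloisRep.hasFrobCharpolyAt_baseChange_iff _ continuous_subtype_val hinj,
      ← Δ.baseChange_padicAlgCl_eq, Polynomial.map_map]
    have hcomp : (algebraMap (padicCoeffField ι) (PadicAlgCl p)).comp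
        (((ι.comp (IntermediateField.inclusion (coeffCharField_liftToGamma1_le (isNewform0_ne_zero hg))).toRingHom).codRestrict
          (padicCoeffField ι).toSubalgebra.toSubring.toSubsemiring fun _ ↦ map_mem_padicCoeffField ι _)) =
        ι.comp (IntermediateField.inclusion (coeffCharField_liftToGamma1_le (isNewform0_ne_zero hg))).toRingHom :=
      RingHom.ext fun x ↦ rfl
    rw [hcomp]
    exact Δ.isGaloisRepOfNewform1_baseChange_padicAlgCl hg hk v hv |>.2

/-- **The datum is absolutely irreducible over `K`** (Ribet 1977 Thm. (2.3), PROVED in the tree, with oddness: `isAbsolutelyIrreducible_of_thm23`).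
[cite: Ribet1977, Thm. (2.3)] [cite: DarmonDiamondTaylor1995, Thm. 3.1 (c)] -/
theorem OrdinaryNewformDatum.isAbsolutelyIrreducible_baseChange_padicCoeffField (Δ : OrdinaryNewformDatum g p ι)
    (hg : IsNewform0 g) (hk : 1 ≤ k) [FiniteDimensional ℚ_[p] (padicCoeffField ι)] :
    FramedRep.IsAbsolutelyIrreducible
      (FramedRep.baseChange (padicCoeffIntegers ι).subtype continuous_padicCoeffIntegers_subtype Δ.ρ) := by
  haveI : IsModuleTopology ℚ_[p] (padicCoeffField ι) := isModuleTopology_padicCoeffField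
  have hg1 : IsNewform1 (liftToGamma1 M k g) := (isNewform1_liftToGamma1_iff_holds M k g).mpr hg
  exact Ribet1977.isAbsolutelyIrreducible_of_thm23 Ribet1977.thm23_isIrreducible_holds hg1 hk
    (Δ.isGaloisRepOfNewform1_baseChange_padicCoeffField hg hk)

/-- **The datum's base change to `ℚ̄_p` is irreducible.** [cite: Ribet1977, Thm. (2.3)] -/
theorem OrdinaryNewformDatum.isIrreducible_baseChange_padicAlgCl (Δ : OrdinaryNewformDatum g p ι)
    (hg : IsNewform0 g) (hk : 1 ≤ k) [FiniteDimensional ℚ_[p] (padicCoeffField ι)] :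
    (FramedGaloisRep.toGaloisRep
      (FramedRep.baseChange (padicCoeffIntegers.toPadicAlgCl ι) continuous_toPadicAlgCl Δ.ρ)).IsIrreducible := by
  rw [Δ.baseChange_padicAlgCl_eq]
  exact Δ.isAbsolutelyIrreducible_baseChange_padicCoeffField hg hk (PadicAlgCl p)
    (algebraMap (padicCoeffField ι) (PadicAlgCl p))

end Literature.NumberTheory.EllipticCurves.GreenbergSelmer

end
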